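import Summits.BirchSwinnertonDyer.BirchSwinnertonDyer.Theorems.KolyvaginDepthDoorSelmerCountReading
import Literature.NumberTheory.EllipticCurves.HeegnerPointsKolyvaginDepthDescent
import Literature.NumberTheory.EllipticCurves.McCallum1991.EigenclassesCebotarevLevelPow
import Literature.NumberTheory.EllipticCurves.SelmerGaloisAction
import HarnessLib

/-!
# Route `KolyvaginDepthDoor`, crux `KolyvaginDepthSupply` (stmt-BirchSwinnertonDyer-21765) —
# the door WITHOUT Kolyvagin's structure theorem ON THE CRUX'S OWN OBJECTS: a system of
# Kolyvagin–Heegner data `d n : KolyvaginHeegnerData Dt β ι n`, the bit `c_1(ℓ) ≠ 0` at ONE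
# Kolyvagin prime (Zhang's congruence form, as in the depth table), and rational points

Helper file (`--supports stmt-BirchSwinnertonDyer-21765 --as helper`); it closes nothing and BSD is
not proved by it.

The sibling `…KolyvaginDepthSupplyDoorOfLeaves` states the hF-free door for an abstract class family
on `H¹(K, E[p])` at Gross's Kolyvagin primes (`IsKolyvaginPrime`, Frobenius form). The depth table
of this route (files `…DepthTableRows*`, `…CruxAtCurve*`) speaks the CRUX's currency instead:
concrete data `d : KolyvaginHeegnerData Dt β ι ℓ` (file `HeegnerPointsOfConductor`), the class
`d.kolyvaginClass hp 1 ∈ H¹(K, E[p^1])`, and Kolyvagin primes in W. Zhang's congruence form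
`Zhang2014.IsKolyvaginPrime N_E W K p ℓ` (`ℓ ∤ N_E d_K p`, inert, `p ∣ ℓ + 1`, `p ∣ a_ℓ`). This file
runs Kolyvagin's minimal-depth descent (`Literature…KolyvaginDescent.HypothesesDepth`, file
`HeegnerPointsKolyvaginDepthDescent`: Gross 1991 §10 at depth `ν`, pure algebra, PROVED) directly in
that currency:

* `exists_hypothesesDepth_of_system` — the abstract data instantiated with `V = H¹(K, E[p^1])`
  (index `((p^1 : ℕ) : ℤ)`, killed by `p`), `τ = conjAct`, `Sel = Sel(E/K)_{p}`,
  `Loc = selmerLocalKer`, `A ℓ = ⨅_{v ∋ ℓ} torsionLocalKer`, `Kol = Zhang2014.IsKolyvaginPrime N_E W K p`,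
  classes `n ↦ (d n).kolyvaginClass hp 1` of a SYSTEM `d : Π n, KolyvaginHeegnerData Dt β ι n`, and
  Čebotarev = the tree's THEOREM `McCallum1991.cor32_eigenclasses_infinite_primes_localOrder_holds`
  (McCallum Cor. 3.2 at level `p^M`, `M = 1`, which delivers primes in exactly Zhang's form). The
  Euler-system and duality inputs are HYPOTHESES in the crux's currency (see "Trust base").
* `natCard_selmerGroup_le_of_kolyvaginClass_ne_zero_of_system` — ONE non-zero class
  `(d n₁).kolyvaginClass hp 1 ≠ 0` (`n₁` a square-free product of Kolyvagin primes with `ν₁` prime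
  factors) ⟹ `Sel(E/K)_p` finite of order `≤ p^{2ν₁+1}`.
* (sibling file `…DoorOfSystemReading`)
  `shaCorank_eq_zero_of_kolyvaginClass_ne_zero_of_points_of_system` — with `a ≤ rank E(ℚ)`,
  `b ≤ rank E^{(d_K)}(ℚ)`, `a + b = 2ν₁ + 1`: `corank_{ℤ_p} Ш(E/ℚ)[p^∞] = 0` (and `rank E = a`,
  `rank E^{(d_K)} = b`, `t_p(E^{(d_K)}) = 0`) — via the unconditional reading
  `rank_and_shaCorank_of_natCard_selmerGroup_baseChange_le` (file `…SelmerCountReading`).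
* (sibling file `…DoorOfSystemReading`)
  `shaCorank_eq_zero_of_rank_two_of_kolyvaginClass_prime_ne_zero_of_system` — **the depth-table row
  without `hF`**: the row's bit `(d ℓ).kolyvaginClass hp 1 ≠ 0` at one Kolyvagin prime `ℓ`, two
  independent points on `E(ℚ)` and one point of infinite order on `E^{(d_K)}(ℚ)` give `t_p(E) = 0`,
  `rank E(ℚ) = 2`, `rank E^{(d_K)}(ℚ) = 1`. Compare the hF-row certificate
  `shaCorank_eq_zero_of_rank_two_of_kolyvaginClass_prime_ne_zero` (file `…KolyvaginDepthSupplyDoor`).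

## Trust base (hypotheses of the theorems, each a printed statement about Kolyvagin's classes)

* `hτc` — **Gross 1991 Prop. 5.4 (2) / McCallum 1991 §5** (`c_M(n) ∈ H¹(K, E_{p^M})^{ε(−1)^r}`):
  the system's classes are `τ`-eigenclasses of sign `ε(−1)^{#{q ∣ n}}` for one `ε = ±1`.
* `hfin`, `hinf` — **McCallum 1991 Lemma 4.3** (`c_M(n)_v ∈ δ(E(K_v))` for `v` prime to `n`; at the
  complex place `H¹ = 0`): the classes satisfy the Selmer condition off `n`.
* `h44` — **McCallum 1991 Prop. 4.4 "in particular"** (`ord d_M(mℓ)_λ = ord c_M(mℓ)_λ = ord c_M(m)_λ`,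
  case `j = 0`): for the tree's concrete classes this IS the named fact
  `McCallum1991.prop44_localOrder_kolyvaginClass_mul_eq` read through
  `McCallum1991.kolyvaginClass_mul_mem_{selmer,torsion}LocalKer_iff_of_prop44` for a system whose data
  are compatible along `K_m ⊆ K_{mℓ}` (one system of choices `σ_ℓ`, `S`, `K̄`, as in print) — taken
  here in its two-line consequence form so that the compatibility bookkeeping stays with the consumer.
* `hcyc` — **Gross 1991 Prop. 8.1 (1)** (the `±`-eigenspaces of `E(K_λ)/p` are lines) and
  `hdual` — **the reciprocity law at finitely many Kolyvagin places** (Gross's proof of Prop. 8.2;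
  McCallum Prop. 2.2 + Lemma 5.3), both at Zhang's Kolyvagin primes (the Literature named facts
  `Gross1991_prop_8_1_one`, `Gross1991_prop_8_2_finset` of `HeegnerPointsKolyvaginDepthDescentLeaves`
  record the same statements at Gross's primes; Prop. 8.1 needs exactly `ℓ + 1 ≡ a_ℓ ≡ 0 (p)`, `ℓ`
  inert of good reduction — Zhang's conditions).
* the point certificates `a ≤ rank E(ℚ)`, `b ≤ rank E^{(d_K)}(ℚ)`; `p` odd with `ρ̄_{E,p^n}` onto for
  all `n` (McCallum's image hypothesis, as in every `McCallum1991.*` fact; for `p ≥ 5` it follows from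
  `ρ̄_{E,p}` onto by Serre).
NOT used: Kolyvagin 1991 Thm. 4 (`hF`), BCGS, any `L`-function. Čebotarev and the descent algebra are
theorems of the tree. Per-curve; conditional on the displayed hypotheses; BSD is not proved by it.

References: [GrossLMS1991] §§5–10; [McCallumLMS1991] Prop. 2.2, Cor. 3.2, Lemma 4.3, Prop. 4.4,
Lemma 5.3; [Kolyvagin1991MathAnn] Thm. 2.3; [WZhang2014] Notations (xii); [SilvermanAEC2009] X.4.2.
-/

set_option linter.dupNamespace false

noncomputable section

open scoped Classical

namespace Summit.BirchSwinnertonDyer.BirchSwinnertonDyer.Theorems.KolyvaginDepthDoor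

open Literature.NumberTheory.EllipticCurves Literature.NumberTheory.EllipticCurves.ModularForms
  Literature.NumberTheory.EllipticCurves.KolyvaginDescent WeierstrassCurve NumberField
  IsDedekindDomain

/-! ## The place of a Kolyvagin prime (Zhang's form) -/

/-- **The place `λ = (ℓ)` of `K` above an inert Kolyvagin prime is the only finite place containing
`ℓ`** (Gross 1991, §3: *"we let `λ` denote its unique prime factor"*; here for Zhang's predicate,
whose fifth conjunct is the primality of `(ℓ) ⊆ 𝓞_K`): `ℓ ∈ v ↔ v = λ`. [cite: GrossLMS1991, §3] -/
theorem mem_asIdeal_iff_eq_of_zhangKolyvaginPrime {N : ℕ} {W : WeierstrassCurve ℚ}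
    [W.IsGloballyMinimal] {K : Type} [Field K] [NumberField K] {p ℓ : ℕ}
    (h : Zhang2014.IsKolyvaginPrime N W K p ℓ) (v : HeightOneSpectrum (𝓞 K)) :
    (ℓ : 𝓞 K) ∈ v.asIdeal ↔
      v = ⟨Ideal.span {(ℓ : 𝓞 K)}, h.2.2.2.2.1, by
        rw [Ne, Ideal.span_singleton_eq_bot]; exact_mod_cast h.1.ne_zero⟩ := by
  constructor
  · intro hv
    apply HeightOneSpectrum.ext
    have hle : Ideal.span {(ℓ : 𝓞 K)} ≤ v.asIdeal := (Ideal.span_singleton_le_iff_mem _).mpr hv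
    have hne : Ideal.span {(ℓ : 𝓞 K)} ≠ ⊥ := by
      rw [Ne, Ideal.span_singleton_eq_bot]; exact_mod_cast h.1.ne_zero
    exact ((Ideal.IsPrime.isMaximal h.2.2.2.2.1 hne).eq_of_le v.isPrime.ne_top hle).symm
  · rintro rfl
    exact Ideal.mem_span_singleton_self _

/-! ## The descent data on `H¹(K, E[p^1])` for a system of Kolyvagin–Heegner data -/

section System

variable {W : WeierstrassCurve ℚ} [W.IsElliptic] [W.IsGloballyMinimal] [NeZero (W.conductorNorm ℤ)]
  {K : Type} [Field K] [NumberField K]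
  {Dt : ModularParametrizationData W (W.conductorNorm ℤ)} {β : ℤ} {ι : K →+* ℂ}

/-- **Kolyvagin's minimal-depth descent data on the crux's objects.** `E/ℚ` globally minimal without
CM, `K` imaginary quadratic (complex conjugation `c`, `c² = 1`), `p` an odd prime with
`ρ̄_{E,p^n}` onto for all `n`, a frame `(Dt, β, ι)` and a SYSTEM `d n : KolyvaginHeegnerData Dt β ι n`
of Kolyvagin–Heegner data with classes `c(n) := (d n).kolyvaginClass hp 1 ∈ H¹(K, E[p^1])`. Granted,
as hypotheses in the crux's currency: the sign law (Gross Prop. 5.4 (2), `hτc`), McCallum's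
Lemma 4.3 (`hfin`, `hinf`), Prop. 4.4 "in particular" for the system (`h44`), Gross's Prop. 8.1 (1)
(`hcyc`) and the reciprocity law at finitely many Kolyvagin places (`hdual`), there is a
`KolyvaginDescent.HypothesesDepth` on `V = H¹(K, E[p^1])` with `Sel = Sel(E/K)`, `τ = conjAct W c`,
Kolyvagin primes `Zhang2014.IsKolyvaginPrime N_E W K p`, classes `c`, and Čebotarev supplied by the
THEOREM `McCallum1991.cor32_eigenclasses_infinite_primes_localOrder_holds` (`M = 1`).
[cite: GrossLMS1991, §10 (setting) with Props. 5.4, 6.2, 8.1, 8.2]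
[cite: McCallumLMS1991, Cor. 3.2, Lemma 4.3, Prop. 4.4] -/
theorem exists_hypothesesDepth_of_system (hcm : ¬ W.HasCM) (hK : IsImaginaryQuadratic K)
    (p : ℕ) [hp : Fact p.Prime] (hp2 : p ≠ 2)
    (htower : ∀ n : ℕ, W.HasSurjectiveModNGaloisRep (p ^ n : ℕ))
    (c : K ≃ₐ[ℚ] K) (hc : c ≠ 1) (hcc : c * c = 1)
    (d : ∀ n : ℕ, KolyvaginHeegnerData Dt β ι n) (ε : ℤ) (hε : ε = 1 ∨ ε = -1)
    (hτc : ∀ n : ℕ, Squarefree n →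
      (∀ q ∈ n.primeFactors, Zhang2014.IsKolyvaginPrime (W.conductorNorm ℤ) W K p q) →
      conjAct W c ((p ^ 1 : ℕ) : ℤ) ((d n).kolyvaginClass hp.out 1) =
        (ε * (-1) ^ n.primeFactors.card) • (d n).kolyvaginClass hp.out 1)
    (hfin : ∀ n : ℕ, Squarefree n →
      (∀ q ∈ n.primeFactors, Zhang2014.IsKolyvaginPrime (W.conductorNorm ℤ) W K p q) →
      ∀ v : HeightOneSpectrum (𝓞 K), (n : 𝓞 K) ∉ v.asIdeal →
        (d n).kolyvaginClass hp.out 1 ∈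
          selmerLocalKer (W.baseChange K) (v.adicCompletion K) ((p ^ 1 : ℕ) : ℤ))
    (hinf : ∀ n : ℕ, Squarefree n →
      (∀ q ∈ n.primeFactors, Zhang2014.IsKolyvaginPrime (W.conductorNorm ℤ) W K p q) →
      ∀ w : InfinitePlace K,
        (d n).kolyvaginClass hp.out 1 ∈ selmerLocalKer (W.baseChange K) w.Completion ((p ^ 1 : ℕ) : ℤ))
    (h44 : ∀ (ℓ m : ℕ), Squarefree (ℓ * m) →
      (∀ q ∈ (ℓ * m).primeFactors, Zhang2014.IsKolyvaginPrime (W.conductorNorm ℤ) W K p q) →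
      Zhang2014.IsKolyvaginPrime (W.conductorNorm ℤ) W K p ℓ →
      ∀ v : HeightOneSpectrum (𝓞 K), (ℓ : 𝓞 K) ∈ v.asIdeal →
        ((d (ℓ * m)).kolyvaginClass hp.out 1 ∈
            selmerLocalKer (W.baseChange K) (v.adicCompletion K) ((p ^ 1 : ℕ) : ℤ) ↔
          (d m).kolyvaginClass hp.out 1 ∈
            (W.baseChange K).torsionLocalKer (v.adicCompletion K) ((p ^ 1 : ℕ) : ℤ)))
    (hcyc : ∀ ℓ : ℕ, Zhang2014.IsKolyvaginPrime (W.conductorNorm ℤ) W K p ℓ →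
      ∀ e : ℤ, (e = 1 ∨ e = -1) →
      ∀ s₁ ∈ selmerGroup (W.baseChange K) ((p ^ 1 : ℕ) : ℤ),
        conjAct W c ((p ^ 1 : ℕ) : ℤ) s₁ = e • s₁ →
      ∀ s₂ ∈ selmerGroup (W.baseChange K) ((p ^ 1 : ℕ) : ℤ),
        conjAct W c ((p ^ 1 : ℕ) : ℤ) s₂ = e • s₂ →
      ∃ a b : ℤ, ¬ ((p : ℤ) ∣ a ∧ (p : ℤ) ∣ b) ∧
        ∀ v : HeightOneSpectrum (𝓞 K), (ℓ : 𝓞 K) ∈ v.asIdeal →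
          a • s₁ + b • s₂ ∈ (W.baseChange K).torsionLocalKer (v.adicCompletion K) ((p ^ 1 : ℕ) : ℤ))
    (hdual : ∀ (T : Finset ℕ), (∀ q ∈ T, Zhang2014.IsKolyvaginPrime (W.conductorNorm ℤ) W K p q) →
      ∀ ℓ ∈ T, ∀ e : ℤ, (e = 1 ∨ e = -1) →
      ∀ x : galH1Torsion (W.baseChange K) ((p ^ 1 : ℕ) : ℤ),
        conjAct W c ((p ^ 1 : ℕ) : ℤ) x = e • x →
        (∀ v : HeightOneSpectrum (𝓞 K), (∀ q ∈ T, (q : 𝓞 K) ∉ v.asIdeal) →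
          x ∈ selmerLocalKer (W.baseChange K) (v.adicCompletion K) ((p ^ 1 : ℕ) : ℤ)) →
        (∀ w : InfinitePlace K, x ∈ selmerLocalKer (W.baseChange K) w.Completion ((p ^ 1 : ℕ) : ℤ)) →
      ∀ s ∈ selmerGroup (W.baseChange K) ((p ^ 1 : ℕ) : ℤ),
        conjAct W c ((p ^ 1 : ℕ) : ℤ) s = e • s →
        (∀ q ∈ T, q ≠ ℓ → ∀ v : HeightOneSpectrum (𝓞 K), (q : 𝓞 K) ∈ v.asIdeal →
          s ∈ (W.baseChange K).torsionLocalKer (v.adicCompletion K) ((p ^ 1 : ℕ) : ℤ)) →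
        ∀ v : HeightOneSpectrum (𝓞 K), (ℓ : 𝓞 K) ∈ v.asIdeal →
          s ∉ (W.baseChange K).torsionLocalKer (v.adicCompletion K) ((p ^ 1 : ℕ) : ℤ) →
          x ∈ selmerLocalKer (W.baseChange K) (v.adicCompletion K) ((p ^ 1 : ℕ) : ℤ)) :
    ∃ S : HypothesesDepth (galH1Torsion (W.baseChange K) ((p ^ 1 : ℕ) : ℤ))
        (HeightOneSpectrum (𝓞 K) ⊕ InfinitePlace K),
      S.Sel = selmerGroup (W.baseChange K) ((p ^ 1 : ℕ) : ℤ) ∧ S.p = p ∧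
        S.c = (fun n ↦ (d n).kolyvaginClass hp.out 1) ∧
        S.Kol = Zhang2014.IsKolyvaginPrime (W.conductorNorm ℤ) W K p ∧
        S.τ = conjAct W c ((p ^ 1 : ℕ) : ℤ) := by
  have hpP : p.Prime := hp.out
  have h32 := McCallum1991.cor32_eigenclasses_infinite_primes_localOrder_holds (W.conductorNorm ℤ) W
    hcm K hK p hpP hp2 htower c hc 1 le_rfl
  -- the place of a Kolyvagin prime and the strict local condition there
  let plZ : ∀ ℓ : ℕ, Zhang2014.IsKolyvaginPrime (W.conductorNorm ℤ) W K p ℓ →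
      HeightOneSpectrum (𝓞 K) := fun ℓ h ↦
    ⟨Ideal.span {(ℓ : 𝓞 K)}, h.2.2.2.2.1, by
      rw [Ne, Ideal.span_singleton_eq_bot]; exact_mod_cast h.1.ne_zero⟩
  have hplZ : ∀ (ℓ : ℕ) (h : Zhang2014.IsKolyvaginPrime (W.conductorNorm ℤ) W K p ℓ)
      (v : HeightOneSpectrum (𝓞 K)), (ℓ : 𝓞 K) ∈ v.asIdeal ↔ v = plZ ℓ h :=
    fun ℓ h v ↦ mem_asIdeal_iff_eq_of_zhangKolyvaginPrime h v
  have hmemZ : ∀ (ℓ : ℕ) (h : Zhang2014.IsKolyvaginPrime (W.conductorNorm ℤ) W K p ℓ),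
      (ℓ : 𝓞 K) ∈ (plZ ℓ h).asIdeal := fun ℓ h ↦ (hplZ ℓ h _).mpr rfl
  have hcast : ((p ^ 1 : ℕ) : ℤ) = (p : ℤ) := by rw [pow_one]
  have htors : ∀ v : galH1Torsion (W.baseChange K) ((p ^ 1 : ℕ) : ℤ), (p : ℤ) • v = 0 := by
    intro v
    have h := zsmul_discreteH1_torsion ((p ^ 1 : ℕ) : ℤ) v
    have e : ((p ^ 1 : ℕ) : ℤ) • v = (p : ℤ) • v := congrArg (fun z : ℤ ↦ z • v) hcast
    rw [← e]
    exact h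
  exact ⟨
    { p := p
      hp := hpP
      hp2 := hp2
      torsion := htors
      τ := conjAct W c ((p ^ 1 : ℕ) : ℤ)
      τ_τ := conjAct_conjAct_of_mul_self W hcc _
      Sel := selmerGroup (W.baseChange K) ((p ^ 1 : ℕ) : ℤ)
      τ_mem := fun s hs ↦ conjAct_mem_selmerGroup W hK.2.isComplex c _ hs
      Loc := Sum.elim
        (fun v ↦ selmerLocalKer (W.baseChange K) (v.adicCompletion K) ((p ^ 1 : ℕ) : ℤ))
        (fun w ↦ selmerLocalKer (W.baseChange K) w.Completion ((p ^ 1 : ℕ) : ℤ))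
      mem_sel_iff := fun s ↦ by rw [mem_selmerGroup_iff, Sum.forall]; rfl
      Kol := Zhang2014.IsKolyvaginPrime (W.conductorNorm ℤ) W K p
      prime_of_kol := fun ℓ h ↦ h.1
      pl := fun ℓ ↦ if h : Zhang2014.IsKolyvaginPrime (W.conductorNorm ℤ) W K p ℓ then
        Sum.inl (plZ ℓ h) else Sum.inr (Classical.arbitrary _)
      Dv := fun v n ↦ Sum.elim (fun v ↦ (n : 𝓞 K) ∈ v.asIdeal) (fun _ ↦ False) v
      dv_iff := fun ℓ hℓ v ↦ by
        rw [dif_pos hℓ]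
        rcases v with v | w
        · simp only [Sum.elim_inl, Sum.inl.injEq]
          exact hplZ ℓ hℓ v
        · simp
      dv_mul := fun a b v ↦ by
        rcases v with v | w
        · exact natCast_mul_mem_asIdeal
        · simp
      dv_one := fun v ↦ by
        rcases v with v | w
        · simp only [Sum.elim_inl, Nat.cast_one]
          exact v.asIdeal.ne_top_iff_one.mp v.isPrime.ne_top
        · simp
      A := fun ℓ ↦ ⨅ (v : HeightOneSpectrum (𝓞 K)) (_ : (ℓ : 𝓞 K) ∈ v.asIdeal),
        (W.baseChange K).torsionLocalKer (v.adicCompletion K) ((p ^ 1 : ℕ) : ℤ)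
      ε := ε
      hε := hε
      c := fun n ↦ (d n).kolyvaginClass hp.out 1
      τ_c := fun n hn ↦ hτc n hn.1 hn.2
      c_mem_loc := fun n hn v hv ↦ by
        rcases v with v | w
        · exact hfin n hn.1 hn.2 v hv
        · exact hinf n hn.1 hn.2 w
      c_mem_loc_iff := fun ℓ m hℓ hn ↦ by
        rw [dif_pos hℓ]
        simp only [Sum.elim_inl, AddSubgroup.mem_iInf]
        rw [h44 ℓ m hn.1 hn.2 hℓ (plZ ℓ hℓ) (hmemZ ℓ hℓ)]
        constructor
        · intro h v hv
          rwa [(hplZ ℓ hℓ v).mp hv]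
        · intro h
          exact h (plZ ℓ hℓ) (hmemZ ℓ hℓ)
      duality := fun T hT ℓ hℓT e he x hx hoff s hs hτs hsT hsℓ ↦ by
        have hℓ : Zhang2014.IsKolyvaginPrime (W.conductorNorm ℤ) W K p ℓ := hT ℓ hℓT
        rw [dif_pos hℓ]
        simp only [Sum.elim_inl]
        have hsv : s ∉ (W.baseChange K).torsionLocalKer ((plZ ℓ hℓ).adicCompletion K)
            ((p ^ 1 : ℕ) : ℤ) := by
          intro h
          apply hsℓ
          simp only [AddSubgroup.mem_iInf]
          intro v hv
          rwa [(hplZ ℓ hℓ v).mp hv]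
        refine hdual T hT ℓ hℓT e he x hx (fun v hv ↦ ?_) (fun w ↦ ?_) s hs hτs
          (fun q hq hne v hv ↦ ?_) (plZ ℓ hℓ) (hmemZ ℓ hℓ) hsv
        · exact hoff (Sum.inl v) fun q hq heq ↦ by
            have hq' : Zhang2014.IsKolyvaginPrime (W.conductorNorm ℤ) W K p q := hT q hq
            rw [dif_pos hq'] at heq
            exact hv q hq ((hplZ q hq' v).mpr (Sum.inl_injective heq))
        · exact hoff (Sum.inr w) fun q hq heq ↦ by
            have hq' : Zhang2014.IsKolyvaginPrime (W.conductorNorm ℤ) W K p q := hT q hq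
            rw [dif_pos hq'] at heq
            exact Sum.inr_ne_inl heq
        · have hsA := hsT q hq hne
          simp only [AddSubgroup.mem_iInf] at hsA
          exact hsA v hv
      local_cyclic := fun ℓ hℓ e he s₁ hs₁ hτ₁ s₂ hs₂ hτ₂ ↦ by
        obtain ⟨a, b, hab, hmem⟩ := hcyc ℓ hℓ e he s₁ hs₁ hτ₁ s₂ hs₂ hτ₂
        refine ⟨a, b, hab, ?_⟩
        simp only [AddSubgroup.mem_iInf]
        exact hmem
      cebotarev := fun r cs Nv hN hτ hind b ↦ by
        -- independence mod `p` gives non-vanishing and McCallum's order form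
        have hne : ∀ i, cs i ≠ 0 := by
          intro i hi
          have h := hind (fun j ↦ if j = i then 1 else 0) (by
            rw [Finset.sum_eq_single i (fun j _ hj ↦ by rw [if_neg hj, zero_zsmul])
              (fun h ↦ absurd (Finset.mem_univ i) h), if_pos rfl, one_zsmul, hi]) i
          rw [if_pos rfl] at h
          have : (p : ℤ) ≤ 1 := Int.le_of_dvd one_pos h
          have : (2 : ℤ) ≤ p := by exact_mod_cast hpP.two_le
          omega
        have hord : ∀ i, addOrderOf (cs i) = p ^ (fun _ : Fin r ↦ 1) i := by
          intro i
          show addOrderOf (cs i) = p ^ 1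
          exact (addOrderOf_eq_prime (by rw [← natCast_zsmul]; exact htors (cs i)) (hne i)).trans
            (pow_one p).symm
        have hind' : ∀ a : Fin r → ℤ, ∑ i, a i • cs i = 0 → ∀ i, (addOrderOf (cs i) : ℤ) ∣ a i := by
          intro a ha i
          rw [hord i, pow_one]
          exact hind a ha i
        obtain ⟨ℓ, ⟨-, hℓ, -, hloc⟩, hlt⟩ :=
          (h32 r cs hne hτ hind' (fun _ ↦ 1) hord Nv hN).exists_gt b
        refine ⟨ℓ, hlt, hℓ, fun i ↦ ?_⟩
        simp only [AddSubgroup.mem_iInf]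
        have key : ∀ v : HeightOneSpectrum (𝓞 K), (ℓ : 𝓞 K) ∈ v.asIdeal →
            (cs i ∈ (W.baseChange K).torsionLocalKer (v.adicCompletion K) ((p ^ 1 : ℕ) : ℤ) ↔
              Nv i = 0) := by
          intro v hv
          have h0 := hloc i v hv 0
          rw [pow_zero, Nat.cast_one, one_zsmul, Nat.le_zero] at h0
          exact h0
        constructor
        · intro h
          exact (key (plZ ℓ hℓ) (hmemZ ℓ hℓ)).mp (h (plZ ℓ hℓ) (hmemZ ℓ hℓ))
        · intro h v hv
          exact (key v hv).mpr h }, rfl, rfl, rfl, rfl, rfl⟩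

/-- **`#Sel(E/K)_p ≤ p^{2ν₁+1}` from ONE non-zero class of the system** (Kolyvagin 1991, Thm. 2.3,
upper half at level `p`): in the setting of `exists_hypothesesDepth_of_system`, if
`(d n₁).kolyvaginClass hp 1 ≠ 0` for a square-free product `n₁` of Kolyvagin primes with `ν₁` prime
factors, then `Sel(E/K)_p` (index `p^1`) is finite of order at most `p^{2ν₁+1}`
(`HypothesesDepth.card_sel_le_of_ne_zero`). Same hypotheses; BSD is not proved by it.
[cite: Kolyvagin1991MathAnn, Thm. 2.3] [cite: GrossLMS1991, §10] -/
theorem natCard_selmerGroup_le_of_kolyvaginClass_ne_zero_of_system (hcm : ¬ W.HasCM)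
    (hK : IsImaginaryQuadratic K) (p : ℕ) [hp : Fact p.Prime] (hp2 : p ≠ 2)
    (htower : ∀ n : ℕ, W.HasSurjectiveModNGaloisRep (p ^ n : ℕ))
    (c : K ≃ₐ[ℚ] K) (hc : c ≠ 1) (hcc : c * c = 1)
    (d : ∀ n : ℕ, KolyvaginHeegnerData Dt β ι n) (ε : ℤ) (hε : ε = 1 ∨ ε = -1)
    (hτc : ∀ n : ℕ, Squarefree n →
      (∀ q ∈ n.primeFactors, Zhang2014.IsKolyvaginPrime (W.conductorNorm ℤ) W K p q) →
      conjAct W c ((p ^ 1 : ℕ) : ℤ) ((d n).kolyvaginClass hp.out 1) =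
        (ε * (-1) ^ n.primeFactors.card) • (d n).kolyvaginClass hp.out 1)
    (hfin : ∀ n : ℕ, Squarefree n →
      (∀ q ∈ n.primeFactors, Zhang2014.IsKolyvaginPrime (W.conductorNorm ℤ) W K p q) →
      ∀ v : HeightOneSpectrum (𝓞 K), (n : 𝓞 K) ∉ v.asIdeal →
        (d n).kolyvaginClass hp.out 1 ∈
          selmerLocalKer (W.baseChange K) (v.adicCompletion K) ((p ^ 1 : ℕ) : ℤ))
    (hinf : ∀ n : ℕ, Squarefree n →
      (∀ q ∈ n.primeFactors, Zhang2014.IsKolyvaginPrime (W.conductorNorm ℤ) W K p q) →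
      ∀ w : InfinitePlace K,
        (d n).kolyvaginClass hp.out 1 ∈ selmerLocalKer (W.baseChange K) w.Completion ((p ^ 1 : ℕ) : ℤ))
    (h44 : ∀ (ℓ m : ℕ), Squarefree (ℓ * m) →
      (∀ q ∈ (ℓ * m).primeFactors, Zhang2014.IsKolyvaginPrime (W.conductorNorm ℤ) W K p q) →
      Zhang2014.IsKolyvaginPrime (W.conductorNorm ℤ) W K p ℓ →
      ∀ v : HeightOneSpectrum (𝓞 K), (ℓ : 𝓞 K) ∈ v.asIdeal →
        ((d (ℓ * m)).kolyvaginClass hp.out 1 ∈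
            selmerLocalKer (W.baseChange K) (v.adicCompletion K) ((p ^ 1 : ℕ) : ℤ) ↔
          (d m).kolyvaginClass hp.out 1 ∈
            (W.baseChange K).torsionLocalKer (v.adicCompletion K) ((p ^ 1 : ℕ) : ℤ)))
    (hcyc : ∀ ℓ : ℕ, Zhang2014.IsKolyvaginPrime (W.conductorNorm ℤ) W K p ℓ →
      ∀ e : ℤ, (e = 1 ∨ e = -1) →
      ∀ s₁ ∈ selmerGroup (W.baseChange K) ((p ^ 1 : ℕ) : ℤ),
        conjAct W c ((p ^ 1 : ℕ) : ℤ) s₁ = e • s₁ →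
      ∀ s₂ ∈ selmerGroup (W.baseChange K) ((p ^ 1 : ℕ) : ℤ),
        conjAct W c ((p ^ 1 : ℕ) : ℤ) s₂ = e • s₂ →
      ∃ a b : ℤ, ¬ ((p : ℤ) ∣ a ∧ (p : ℤ) ∣ b) ∧
        ∀ v : HeightOneSpectrum (𝓞 K), (ℓ : 𝓞 K) ∈ v.asIdeal →
          a • s₁ + b • s₂ ∈ (W.baseChange K).torsionLocalKer (v.adicCompletion K) ((p ^ 1 : ℕ) : ℤ))
    (hdual : ∀ (T : Finset ℕ), (∀ q ∈ T, Zhang2014.IsKolyvaginPrime (W.conductorNorm ℤ) W K p q) →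
      ∀ ℓ ∈ T, ∀ e : ℤ, (e = 1 ∨ e = -1) →
      ∀ x : galH1Torsion (W.baseChange K) ((p ^ 1 : ℕ) : ℤ),
        conjAct W c ((p ^ 1 : ℕ) : ℤ) x = e • x →
        (∀ v : HeightOneSpectrum (𝓞 K), (∀ q ∈ T, (q : 𝓞 K) ∉ v.asIdeal) →
          x ∈ selmerLocalKer (W.baseChange K) (v.adicCompletion K) ((p ^ 1 : ℕ) : ℤ)) →
        (∀ w : InfinitePlace K, x ∈ selmerLocalKer (W.baseChange K) w.Completion ((p ^ 1 : ℕ) : ℤ)) →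
      ∀ s ∈ selmerGroup (W.baseChange K) ((p ^ 1 : ℕ) : ℤ),
        conjAct W c ((p ^ 1 : ℕ) : ℤ) s = e • s →
        (∀ q ∈ T, q ≠ ℓ → ∀ v : HeightOneSpectrum (𝓞 K), (q : 𝓞 K) ∈ v.asIdeal →
          s ∈ (W.baseChange K).torsionLocalKer (v.adicCompletion K) ((p ^ 1 : ℕ) : ℤ)) →
        ∀ v : HeightOneSpectrum (𝓞 K), (ℓ : 𝓞 K) ∈ v.asIdeal →
          s ∉ (W.baseChange K).torsionLocalKer (v.adicCompletion K) ((p ^ 1 : ℕ) : ℤ) →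
          x ∈ selmerLocalKer (W.baseChange K) (v.adicCompletion K) ((p ^ 1 : ℕ) : ℤ))
    {n₁ : ℕ} (hn₁ : Squarefree n₁)
    (hk₁ : ∀ q ∈ n₁.primeFactors, Zhang2014.IsKolyvaginPrime (W.conductorNorm ℤ) W K p q)
    (hne : (d n₁).kolyvaginClass hp.out 1 ≠ 0) :
    Finite ↥(selmerGroup (W.baseChange K) ((p ^ 1 : ℕ) : ℤ)) ∧
      Nat.card ↥(selmerGroup (W.baseChange K) ((p ^ 1 : ℕ) : ℤ)) ≤
        p ^ (2 * n₁.primeFactors.card + 1) := by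
  obtain ⟨S, hSel, hSp, hSc, hSK, -⟩ := exists_hypothesesDepth_of_system hcm hK p hp2 htower c hc
    hcc d ε hε hτc hfin hinf h44 hcyc hdual
  have hsupp : KolSupp S.Kol n₁ := by rw [hSK]; exact ⟨hn₁, hk₁⟩
  have hne' : S.c n₁ ≠ 0 := by rw [hSc]; exact hne
  obtain ⟨hfinS, hcard, -⟩ := S.card_sel_le_of_ne_zero hsupp hne'
  rw [hSel, hSp] at hcard
  rw [hSel] at hfinS
  exact ⟨hfinS, hcard⟩


end System

end Summit.BirchSwinnertonDyer.BirchSwinnertonDyer.Theorems.KolyvaginDepthDoor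

end
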